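import Literature.Geometry.Lorentzian.HorizonPenetratingTeukolsky
import Literature.Geometry.Lorentzian.KerrSchildHomogeneity
import Literature.Geometry.Lorentzian.KerrSchildWaveCauchyAssembly
import Literature.Geometry.Lorentzian.KerrSliceFacts
import Literature.Geometry.Lorentzian.LeviCivitaProofs
import HarnessLib

/-!
# Dilation covariance of the Teukolsky operator on the horizon-penetrating Kerr–Schild charts

Stub `D1` (`stub_teukolskyOpOn_dilate`) of the line `bounded-kappa-closing-box` for the crux
`BulkKerrCaptureC2` (route `PhaseMixingCapture`). The Kerr family is homothetic: in
Kerr–Schild Cartesian coordinates `g_{λM,λa}(λx) = g_{M,a}(x)` (`Kerr.bilin_dilate`), the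
Kerr–Schild scalar `H` and the null vector `ℓ♯` are dilation invariant (`Kerr.scalarH_dilate`,
`Kerr.nullVector_dilate`), the radius `r` scales by `λ` (`Kerr.radius_smul`). Consequently the
spin-`s` Teukolsky operator
`𝔗^{[s]} = ρ² □_g + 2s(r − M) ∂_r + 2s(a(r−M)/Δ + i cos θ/sin²θ) ∂_φ`
`  + 2s(M(r²−a²)/Δ − r − i a cos θ) ∂_{t*} + (s − s² cot²θ)` (`Kerr.teukolskyOpOn`)
is homogeneous of degree `0` under `(M, a, r₀, x) ↦ (λM, λa, λr₀, λx)`: for `α` on the dilated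
chart `Kerr.region (λa) (λr₀)` whose extension by zero is `C²` at `λx`,
`𝔗_{M,a,r₀}[α ∘ D_λ](x) = 𝔗_{λM,λa,λr₀}[α](λx)` exactly.

Proof. (i) `□_g` of the analytic Kerr metric is (definitionally) `□_g` of its `C^∞` twin
`Kerr.smoothMetric`, which `Kerr.dalembertian_eq_waveOperator` writes as the divergence-form
wave operator of the Kerr–Schild coefficients `(2H, ℓ♯)`; these are dilation invariant, so
`KerrSchild.waveOperator_comp_smul` gives `□_{M,a}(Φ ∘ (λ•))(x) = λ² (□_{λM,λa} Φ)(λx)`,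
while `ρ² = r² + a² cos²θ` scales by `λ²`. (ii) The extension by zero of `α ∘ D_λ` is
`(extension of α) ∘ (λ•)`, so `Kerr.coordDeriv (α ∘ D_λ) x v = λ · Kerr.coordDeriv α (λx) v`
(`fderiv_comp_smul`); `Kerr.blRadialVector` is invariant, `Kerr.blAxialVector` scales by `λ`,
`cos θ`, `sin θ` are invariant and `Δ(λM, λa, λr) = λ² Δ(M, a, r)`: each first-order
coefficient absorbs exactly one factor `λ`. (iii) The zeroth-order term is invariant.

## References

* S. A. Teukolsky, W. H. Press, ApJ 193 (1974), §II (key `TeukolskyPress1974`).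
* R. P. Kerr, A. Schild, 1965, §2 (key `KerrSchild1965`).
-/

-- the doubled `FinalStateConjecture.FinalStateConjecture` path component trips dupNamespace
set_option linter.dupNamespace false

noncomputable section

namespace Summit.FinalStateConjecture.FinalStateConjecture.Theorems.BulkKerrCaptureC2.TeukolskyOpDilate

open Literature.Geometry.Lorentzian
open scoped Manifold ContDiff Topology

variable {lam : ℝ}

/-! ### Dilation of the Boyer–Lindquist quantities of the Kerr–Schild chart -/

/-- Components of a dilated point: `(λx)_i = λ x_i`. [folklore] -/
private theorem smul_coord (lam : ℝ) (x : E4) (i : Fin 4) : (lam • x) i = lam * x i := by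
  simp

/-- `Δ(λM, λa; λr) = λ² Δ(M, a; r)`. [cite: BoyerLindquist1967] -/
private theorem delta_dilate (lam M a r : ℝ) :
    Kerr.delta (lam * M) (lam * a) (lam * r) = lam ^ 2 * Kerr.delta M a r := by
  unfold Kerr.delta
  ring

/-- `cos θ` is dilation invariant: `cos θ (λa; λx) = cos θ (a; x)` (`λ > 0`).
[cite: arXiv07060622, (36)] -/
private theorem cosTheta_dilate (hlam : 0 < lam) (a : ℝ) (x : E4) :
    Kerr.cosTheta (lam * a) (lam • x) = Kerr.cosTheta a x := by
  unfold Kerr.cosTheta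
  rw [Kerr.radius_smul hlam, smul_coord]
  exact mul_div_mul_left _ _ hlam.ne'

/-- The cylindrical radius scales: `ϖ(λx) = λ ϖ(x)` (`λ > 0`). [cite: arXiv07060622, (36)] -/
private theorem axialRadius_dilate (hlam : 0 < lam) (x : E4) :
    Kerr.axialRadius (lam • x) = lam * Kerr.axialRadius x := by
  unfold Kerr.axialRadius
  rw [smul_coord, smul_coord,
    show (lam * x 1) ^ 2 + (lam * x 2) ^ 2 = lam ^ 2 * (x 1 ^ 2 + x 2 ^ 2) by ring,
    Real.sqrt_mul (sq_nonneg lam), Real.sqrt_sq hlam.le]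

/-- `sin θ` is dilation invariant: `sin θ (λa; λx) = sin θ (a; x)` (`λ > 0`).
[cite: arXiv07060622, (36)] -/
private theorem sinTheta_dilate (hlam : 0 < lam) (a : ℝ) (x : E4) :
    Kerr.sinTheta (lam * a) (lam • x) = Kerr.sinTheta a x := by
  unfold Kerr.sinTheta
  rw [axialRadius_dilate hlam, Kerr.radius_smul hlam,
    show (lam * Kerr.radius a x) ^ 2 + (lam * a) ^ 2 = lam ^ 2 * (Kerr.radius a x ^ 2 + a ^ 2)
      by ring,
    Real.sqrt_mul (sq_nonneg lam), Real.sqrt_sq hlam.le]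
  exact mul_div_mul_left _ _ hlam.ne'

/-- `∂_φ = x₁ ∂₂ − x₂ ∂₁` is linear in the point: `∂_φ(λx) = λ ∂_φ(x)`.
[cite: ONeill1995, Ch. 2  §2.2] -/
private theorem blAxialVector_dilate (lam : ℝ) (x : E4) :
    Kerr.blAxialVector (lam • x) = lam • Kerr.blAxialVector x := by
  unfold Kerr.blAxialVector
  rw [smul_coord, smul_coord, smul_sub, smul_smul, smul_smul]

/-- **The Boyer–Lindquist radial vector is dilation invariant**:
`∂_r(λM, λa; λx) = ∂_r(M, a; x)` (`λ > 0`; both sides are junk-consistent on `{Δ = 0}`).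
[cite: arXiv08110354, §5.1] -/
private theorem blRadialVector_dilate (hlam : 0 < lam) (M a : ℝ) (x : E4) :
    Kerr.blRadialVector (lam * M) (lam * a) (lam • x) = Kerr.blRadialVector M a x := by
  have h2 : lam ^ 2 ≠ 0 := pow_ne_zero 2 hlam.ne'
  unfold Kerr.blRadialVector
  rw [Kerr.radius_smul hlam, Kerr.nullCovectorFun_smul hlam, blAxialVector_dilate, delta_dilate,
    smul_smul]
  set r := Kerr.radius a x
  set Δ := Kerr.delta M a r
  have hA : 2 * (lam * M) * (lam * r) / (lam ^ 2 * Δ) = 2 * M * r / Δ := by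
    rw [show 2 * (lam * M) * (lam * r) = lam ^ 2 * (2 * M * r) by ring]
    exact mul_div_mul_left _ _ h2
  have hB : lam * a / (lam ^ 2 * Δ) * lam = a / Δ := by
    rw [div_mul_eq_mul_div, show lam * a * lam = lam ^ 2 * a by ring]
    exact mul_div_mul_left _ _ h2
  rw [hA, hB]

/-- The coefficient `a(r − M)/Δ` of `∂_φ` is dilation invariant. [cite: TeukolskyPress1974, §II] -/
private theorem coeffPhi_dilate (hlam : 0 < lam) (M a r : ℝ) :
    lam * a * (lam * r - lam * M) / Kerr.delta (lam * M) (lam * a) (lam * r) =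
      a * (r - M) / Kerr.delta M a r := by
  rw [delta_dilate, show lam * a * (lam * r - lam * M) = lam ^ 2 * (a * (r - M)) by ring]
  exact mul_div_mul_left _ _ (pow_ne_zero 2 hlam.ne')

/-- The coefficient `M(r² − a²)/Δ − r` of `∂_{t*}` scales by `λ`. [cite: TeukolskyPress1974, §II] -/
private theorem coeffT_dilate (hlam : 0 < lam) (M a r : ℝ) :
    lam * M * ((lam * r) ^ 2 - (lam * a) ^ 2) / Kerr.delta (lam * M) (lam * a) (lam * r) -
        lam * r =
      lam * (M * (r ^ 2 - a ^ 2) / Kerr.delta M a r - r) := by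
  rw [delta_dilate,
    show lam * M * ((lam * r) ^ 2 - (lam * a) ^ 2) = lam ^ 2 * (lam * (M * (r ^ 2 - a ^ 2)))
      by ring,
    mul_div_mul_left _ _ (pow_ne_zero 2 hlam.ne')]
  ring

/-! ### The extension by zero of the pull-back and the coordinate derivatives -/

/-- **The extension by zero of `α ∘ D_λ` is `(extension of α) ∘ D_λ`** (the chart domains are
dilation covariant, `Kerr.mem_region_dilate_iff`). [cite: arXiv08110354, §5.1] -/
private theorem extend_comp_dilate (hlam : 0 < lam) {a r₀ : ℝ}
    (α : Kerr.region (lam * a) (lam * r₀) → ℂ) :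
    Function.extend Subtype.val
        (fun y : Kerr.region a r₀ ↦ α ⟨lam • (y : E4), (Kerr.mem_region_dilate_iff hlam).2 y.2⟩)
        (0 : E4 → ℂ) =
      fun z : E4 ↦ Function.extend Subtype.val α (0 : E4 → ℂ) (lam • z) := by
  funext z
  by_cases hz : z ∈ Kerr.region a r₀
  · have hz' : lam • z ∈ Kerr.region (lam * a) (lam * r₀) :=
      (Kerr.mem_region_dilate_iff hlam).2 hz
    have h1 : Function.extend Subtype.val
        (fun y : Kerr.region a r₀ ↦ α ⟨lam • (y : E4), (Kerr.mem_region_dilate_iff hlam).2 y.2⟩)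
        (0 : E4 → ℂ) z = α ⟨lam • z, hz'⟩ :=
      Subtype.val_injective.extend_apply _ _ ⟨z, hz⟩
    have h2 : Function.extend Subtype.val α (0 : E4 → ℂ) (lam • z) = α ⟨lam • z, hz'⟩ :=
      Subtype.val_injective.extend_apply _ _ ⟨lam • z, hz'⟩
    rw [h1, h2]
  · have hz' : lam • z ∉ Kerr.region (lam * a) (lam * r₀) :=
      fun h ↦ hz ((Kerr.mem_region_dilate_iff hlam).1 h)
    rw [Function.extend_apply' _ _ _ fun ⟨y, hy⟩ ↦ hz (hy ▸ y.2),
      Function.extend_apply' _ _ _ fun ⟨y, hy⟩ ↦ hz' (hy ▸ y.2)]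
    rfl

/-- **The coordinate derivatives of the pull-back scale by `λ`**:
`v(α ∘ D_λ)(x) = λ · v(α)(λx)` (chain rule for the extension by zero, valid for every `α`).
[cite: arXiv08110354, §4.1] -/
private theorem coordDeriv_dilate (hlam : 0 < lam) {a r₀ : ℝ}
    (α : Kerr.region (lam * a) (lam * r₀) → ℂ) (x v : E4) :
    Kerr.coordDeriv
        (fun y : Kerr.region a r₀ ↦ α ⟨lam • (y : E4), (Kerr.mem_region_dilate_iff hlam).2 y.2⟩)
        x v =
      (lam : ℂ) * Kerr.coordDeriv α (lam • x) v := by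
  unfold Kerr.coordDeriv
  rw [extend_comp_dilate hlam α, fderiv_comp_smul lam, smul_apply, Complex.real_smul]

/-- The coordinate derivative is linear in the direction: `(c v)(α) = c · v(α)`. [folklore] -/
private theorem coordDeriv_smul_right {U : TopologicalSpace.Opens E4} (α : U → ℂ) (x v : E4)
    (c : ℝ) : Kerr.coordDeriv α x (c • v) = (c : ℂ) * Kerr.coordDeriv α x v := by
  unfold Kerr.coordDeriv
  rw [map_smul, Complex.real_smul]

/-! ### The wave operator -/

/-- The analytic Kerr metric and its `C^∞` twin `Kerr.smoothMetric = (Kerr.metric).ofLE _` have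
the same components, hence definitionally the same Levi-Civita connection, Hessian and wave
operator. [cite: ONeill1983, Ch. 3, Thm. 3.11] -/
private theorem dalembertian_metric_eq [Kerr.Facts] (M a r₀ : ℝ)
    [(Kerr.metric M a r₀).HasLeviCivita] [(Kerr.smoothMetric M a r₀).HasLeviCivita]
    (f : Kerr.region a r₀ → ℝ) (x : Kerr.region a r₀) :
    (Kerr.metric M a r₀).toPseudoRiemannianMetric.dalembertian f x =
      (Kerr.smoothMetric M a r₀).toPseudoRiemannianMetric.dalembertian f x := by
  unfold PseudoRiemannianMetric.dalembertian PseudoRiemannianMetric.hessian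
    PseudoRiemannianMetric.hessianAux
  simp only [PseudoRiemannianMetric.leviCivita_apply]
  rfl

/-- The Kerr–Schild coefficients `(2H, ℓ♯)` of `□_g` are dilation invariant:
`g^{μν}_{M,a}(y) = g^{μν}_{λM,λa}(λy)`. [cite: KerrSchild1965, §2] -/
private theorem inverseMetric_dilate (hlam : 0 < lam) (M a : ℝ) :
    KerrSchild.inverseMetric (fun y ↦ 2 * Kerr.scalarH M a y) (Kerr.nullVector a) =
      fun y ↦ KerrSchild.inverseMetric (fun y ↦ 2 * Kerr.scalarH (lam * M) (lam * a) y)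
        (Kerr.nullVector (lam * a)) (lam • y) := by
  funext y μ ν
  simp only [KerrSchild.inverseMetric, Kerr.scalarH_dilate hlam, Kerr.nullVector_dilate hlam]

/-- **Dilation covariance of `□_g` on real parts of complex fields**: for a real-linear
`L : ℂ →L[ℝ] ℝ` (e.g. `Re`, `Im`) and `α` on the dilated chart with extension `C²` at `λx`,
`□_{M,a,r₀} (L ∘ α ∘ D_λ)(x) = λ² □_{λM,λa,λr₀} (L ∘ α)(λx)`. [cite: KerrSchild1965, §2] -/
private theorem dalembertian_dilate [Kerr.Facts] (hlam : 0 < lam) (M a r₀ : ℝ)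
    [(Kerr.metric M a r₀).HasLeviCivita]
    [(Kerr.metric (lam * M) (lam * a) (lam * r₀)).HasLeviCivita]
    (L : ℂ →L[ℝ] ℝ) (α : Kerr.region (lam * a) (lam * r₀) → ℂ) (x : Kerr.region a r₀)
    (hα : ContDiffAt ℝ 2 (Function.extend Subtype.val α (0 : E4 → ℂ)) (lam • (x : E4))) :
    (Kerr.metric M a r₀).toPseudoRiemannianMetric.dalembertian
        (fun y : Kerr.region a r₀ ↦
          L (α ⟨lam • (y : E4), (Kerr.mem_region_dilate_iff hlam).2 y.2⟩)) x =
      lam ^ 2 *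
        (Kerr.metric (lam * M) (lam * a) (lam * r₀)).toPseudoRiemannianMetric.dalembertian
          (fun y ↦ L (α y)) ⟨lam • (x : E4), (Kerr.mem_region_dilate_iff hlam).2 x.2⟩ := by
  haveI : Kerr.SliceFacts := Kerr.sliceFacts_holds
  rw [dalembertian_metric_eq, dalembertian_metric_eq]
  set Φ : E4 → ℂ := Function.extend Subtype.val α (0 : E4 → ℂ) with hΦ
  set x' : Kerr.region (lam * a) (lam * r₀) :=
    ⟨lam • (x : E4), (Kerr.mem_region_dilate_iff hlam).2 x.2⟩
  -- both functions are represented by `L ∘ Φ`, resp. `L ∘ Φ ∘ (λ•)`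
  have hrepR : ∀ y : Kerr.region (lam * a) (lam * r₀),
      (fun y : Kerr.region (lam * a) (lam * r₀) ↦ L (α y)) y = (fun z : E4 ↦ L (Φ z)) y := by
    intro y
    simp only [hΦ, Subtype.val_injective.extend_apply _ _ y]
  have hrepL : ∀ y : Kerr.region a r₀,
      (fun y : Kerr.region a r₀ ↦
          L (α ⟨lam • (y : E4), (Kerr.mem_region_dilate_iff hlam).2 y.2⟩)) y =
        (fun z : E4 ↦ L (Φ (lam • z))) y := by
    intro y
    have h2 : Φ (lam • (y : E4)) = α ⟨lam • (y : E4), (Kerr.mem_region_dilate_iff hlam).2 y.2⟩ :=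
      Subtype.val_injective.extend_apply _ _ ⟨lam • (y : E4), _⟩
    simp only [h2]
  have h2R : ContDiffAt ℝ 2 (fun z : E4 ↦ L (Φ z)) (x' : E4) := L.contDiff.contDiffAt.comp _ hα
  have h2L : ContDiffAt ℝ 2 (fun z : E4 ↦ L (Φ (lam • z))) (x : E4) :=
    show ContDiffAt ℝ 2 ((fun z : E4 ↦ L (Φ z)) ∘ fun z : E4 ↦ lam • z) (x : E4) from
      h2R.comp (x : E4) (contDiff_const_smul lam).contDiffAt
  -- chart formula on both sides, invariance of the coefficients, dilation of the wave operator
  rw [Kerr.dalembertian_eq_waveOperator M a r₀ hrepL x h2L,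
    Kerr.dalembertian_eq_waveOperator (lam * M) (lam * a) (lam * r₀) hrepR x' h2R,
    inverseMetric_dilate hlam M a]
  exact KerrSchild.waveOperator_comp_smul _ (fun z ↦ L (Φ z)) lam x

/-- **Dilation covariance of the complex wave operator**:
`□_{M,a,r₀} (α ∘ D_λ)(x) = λ² □_{λM,λa,λr₀} α (λx)`. [cite: KerrSchild1965, §2] -/
private theorem cdalembertianOn_dilate [Kerr.Facts] (hlam : 0 < lam) (M a r₀ : ℝ)
    [(Kerr.metric M a r₀).HasLeviCivita]
    [(Kerr.metric (lam * M) (lam * a) (lam * r₀)).HasLeviCivita]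
    (α : Kerr.region (lam * a) (lam * r₀) → ℂ) (x : Kerr.region a r₀)
    (hα : ContDiffAt ℝ 2 (Function.extend Subtype.val α (0 : E4 → ℂ)) (lam • (x : E4))) :
    Kerr.cdalembertianOn M a r₀
        (fun y : Kerr.region a r₀ ↦ α ⟨lam • (y : E4), (Kerr.mem_region_dilate_iff hlam).2 y.2⟩)
        x =
      (lam : ℂ) ^ 2 * Kerr.cdalembertianOn (lam * M) (lam * a) (lam * r₀) α
        ⟨lam • (x : E4), (Kerr.mem_region_dilate_iff hlam).2 x.2⟩ := by
  unfold Kerr.cdalembertianOn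
  have hre := dalembertian_dilate hlam M a r₀ Complex.reCLM α x hα
  have him := dalembertian_dilate hlam M a r₀ Complex.imCLM α x hα
  simp only [Complex.reCLM_apply, Complex.imCLM_apply] at hre him
  rw [hre, him]
  push_cast
  ring

/-! ### The theorem -/

/-- **Dilation covariance of the Teukolsky operator** (stub `D1` of the line
`bounded-kappa-closing-box`): for `λ > 0`, `x ∈ {r > r₀}` and a field `α` on the dilated chart
`{r > λr₀}` of Kerr(`λM, λa`) whose extension by zero is `C²` at `λx`,
`𝔗^{[s]}_{M,a,r₀}[α ∘ D_λ](x) = 𝔗^{[s]}_{λM,λa,λr₀}[α](λx)` exactly: the operator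
`ρ² □_g + 2s(r − M)∂_r + 2s(a(r−M)/Δ + i cos θ/sin²θ)∂_φ + 2s(M(r²−a²)/Δ − r − i a cos θ)∂_{t*}`
`  + (s − s² cot²θ)` is homogeneous of degree `0` under `(M, a, x) ↦ (λM, λa, λx)`.
[cite: TeukolskyPress1974, §II] -/
theorem stub_teukolskyOpOn_dilate :
    ∀ [Kerr.Facts] (lam : ℝ) (hlam : 0 < lam) (M a r₀ : ℝ)
      [(Kerr.metric M a r₀).HasLeviCivita]
      [(Kerr.metric (lam * M) (lam * a) (lam * r₀)).HasLeviCivita]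
      (s : ℤ) (α : Kerr.region (lam * a) (lam * r₀) → ℂ) (x : Kerr.region a r₀),
      ContDiffAt ℝ 2 (Function.extend Subtype.val α (0 : E4 → ℂ)) (lam • (x : E4)) →
      Kerr.teukolskyOpOn M a r₀ s
          (fun y : Kerr.region a r₀ ↦ α ⟨lam • (y : E4), (Kerr.mem_region_dilate_iff hlam).2 y.2⟩)
          x =
        Kerr.teukolskyOpOn (lam * M) (lam * a) (lam * r₀) s α
          ⟨lam • (x : E4), (Kerr.mem_region_dilate_iff hlam).2 x.2⟩ := by
  intro _ lam hlam M a r₀ _ _ s α x hα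
  unfold Kerr.teukolskyOpOn
  rw [cdalembertianOn_dilate hlam M a r₀ α x hα]
  simp only [coordDeriv_dilate hlam, Kerr.radius_smul hlam, cosTheta_dilate hlam,
    sinTheta_dilate hlam, blRadialVector_dilate hlam, blAxialVector_dilate, coordDeriv_smul_right,
    coeffPhi_dilate hlam, coeffT_dilate hlam]
  push_cast
  ring

end Summit.FinalStateConjecture.FinalStateConjecture.Theorems.BulkKerrCaptureC2.TeukolskyOpDilate

end
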